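import Mathlib
import Summits.CriticalPhenomena.CardyFormulaZ2.Theorems.CardySelfRefinementDefs
import Summits.CriticalPhenomena.CardyFormulaZ2.Theorems.CardySelfRefinementRussoDriftModel
import Summits.CriticalPhenomena.CardyFormulaZ2.Theorems.CardySelfRefinementRussoDriftPolynomial
import Summits.CriticalPhenomena.CardyFormulaZ2.Theorems.CardySelfRefinementTrivialSectorRateStubOrbitAlignmentConditioning
import Literature.Probability.LatticeModels.ProdBernoulliIndependence
import HarnessLib

/-!
# Helper (M2), part 1, of stub `stub_fourArmAboveOne`, line `far-field-is-a-quarter-turn`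
(crux `TrivialSectorRate`, stmt-CriticalPhenomena-10266): a BK-FRIENDLY READ-OUT of the
self-refinement coins with the same law `M_k`

The crossing-cluster second moment `E[Z²] ≤ C` (van den Berg–Nolin's (G-EZ-bnd), the field `X = Z/2`,
`E[X²] ≤ 1` of the Garban scheme data `hS` of `fourArmAboveOneAlong_of_garbanScheme`) rests on the
tail bound `P(Z ≥ j) ≤ P(A)^j` — `j` distinct crossing clusters are `j` disjoint witnesses of the
crossing event `A`, and BK.  For the dependent model `M_k = (coin product).map (cfg k)` the BK /
Reimer inequality only holds on the COIN space (`prodBernoulli_reimer_local`), for COIN-disjoint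
witnesses, and under the route's read-out `cfg k` two vertex-disjoint open paths in distinct
clusters need NOT have coin-disjoint certificates: if they use the two end sub-edges `e₀`, `e₂` of
one bundle (`k = 3`, middle sub-edge closed, selector off), both certificates must contain the
selector of the bundle.  The remedy of this file is a second read-out of the SAME coins with the
SAME law in which the first sub-edge `e₀` of every bundle reads the SHARED coin whatever the
selector says (`e₀` open iff shared coin on; `e_i`, `i ≥ 1`, open iff (selector on and shared on) or
(selector off and own coin on)); for `k ≤ 3` distinct clusters then always admit coin-disjoint
certificates (`e₀ ↦ {shared}`, `e_i ↦ {selector, shared or own_i}`, and `e₁`, `e₂` share a vertex).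

The second read-out is `S ↦ cfg k {c | swap_S c ∈ S}`, where `swap_σ` exchanges, for every bundle
`(u, d)` whose selector is OFF in `σ`, the shared coin `(u, d, 1)` with the own coin
`(ctr k u, d, 0)` of the first sub-edge, and fixes all other coins (written inline, no definition):

* `swap_involutive`, `prm_swap`, `swap_layer_two_iff`, `swap_congr`, `swap_of_layer_two` — the swap
  at a frozen selector layer is a bias-preserving involution of the coins off the selector layer,
  reading the selector layer only;
* `measurable_readout`, `edgeOf_mem_readout_iff` — measurability and the opening rule of the
  second read-out;
* `coinLaw_map_readout_eq` (registered helper) — **the second read-out has law `M_k(q)`**: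
  conditionally on the selector layer the swap is a fixed bias-preserving coin permutation, which
  preserves the coin product (`prodBernoulli_real_preimage_image_equiv`); the far-field
  disintegration `prodBernoulli_real_eq_integral_cond` (file `…StubOrbitAlignmentConditioning.lean`)
  glues the conditional identities.

References: J. van den Berg, P. Nolin, Progr. Probab. 77 (2020), §3 (eq:upper_bd_C), §5.2;
D. Reimer, Combin. Probab. Comput. 9 (2000); G. Grimmett, *Percolation* (1999), §2.3.

Target file:
`Summits/CriticalPhenomena/CardyFormulaZ2/Theorems/CardySelfRefinementTrivialSectorRateStubFourArmAboveOneSecondMomentReadout.lean`.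
-/

noncomputable section

namespace Summit.CriticalPhenomena.CardyFormulaZ2.Theorems.CardySelfRefinement.FarField

open scoped Classical
open Set MeasureTheory ProbabilityTheory
open Literature.Probability.LatticeModels Literature.Probability.Percolation
open Literature.Probability.Percolation.QuadCrossing
open Summit.CriticalPhenomena.CardyFormulaZ2.Theses.CardySelfRefinement

/-! ### The selector-dependent swap of the shared coin with the own coin of the first sub-edge -/

/-- `tb k (ctr k u, d) = u` for `0 < k`. -/
theorem tb_ctr {k : ℕ} (hk : 0 < k) (u : Site 2) (d : Fin 2) : tb k (ctr k u, d) = u := by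
  funext i
  have hk0 : (k : ℤ) ≠ 0 := by exact_mod_cast hk.ne'
  simp [tb, ctr, Int.mul_ediv_cancel_left _ hk0]

/-- `ctr k (tb k (x, d)) = x` when both coordinates of `x` are multiples of `k`. -/
theorem ctr_tb_of_dvd {k : ℕ} {x : Site 2} (d : Fin 2) (hx : ∀ i, (k : ℤ) ∣ x i) :
    ctr k (tb k (x, d)) = x := by
  funext i
  simp only [ctr, tb]
  exact Int.mul_ediv_cancel' (hx i)

/-- Coordinates of `ctr k u` are multiples of `k`. -/
theorem dvd_ctr_apply (k : ℕ) (u : Site 2) (i : Fin 2) : (k : ℤ) ∣ ctr k u i := ⟨u i, rfl⟩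

/-- An edge based at a point of `kℤ²` is axial (in both directions). -/
theorem ax_of_dvd {k : ℕ} {x : Site 2} (hx : ∀ i, (k : ℤ) ∣ x i) (d : Fin 2) : ax k (x, d) := hx _

/-- **The swap is an involution.**  For every selector configuration `σ`, the map exchanging, for
each bundle `(u, d)` whose selector is OFF in `σ`, the shared coin `(u, d, 1)` with the own coin
`(ctr k u, d, 0)` of the first sub-edge of the bundle, and fixing every other coin, is an
involution of the coin set. -/
theorem swap_involutive {k : ℕ} (hk : 0 < k) (σ : Set Coin) :
    Function.Involutive ((fun (σ : Set Coin) (c : Coin) =>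
      if c.2.2 = 1 then (if (c.1, c.2.1, (2 : Fin 3)) ∈ σ then c else (ctr k c.1, c.2.1, (0 : Fin 3)))
      else if c.2.2 = 0 then
        (if (∀ i, (k : ℤ) ∣ c.1 i) ∧ (tb k (c.1, c.2.1), c.2.1, (2 : Fin 3)) ∉ σ
          then (tb k (c.1, c.2.1), c.2.1, (1 : Fin 3)) else c)
      else c) σ) := by
  rintro ⟨x, d, l⟩
  fin_cases l
  · -- own coin
    by_cases hc : ((k : ℤ) ∣ x 0 ∧ (k : ℤ) ∣ x 1) ∧ (tb k (x, d), d, (2 : Fin 3)) ∉ σ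
    · have h1 : ∀ i, (k : ℤ) ∣ x i := fun i => by fin_cases i <;> simp [hc.1.1, hc.1.2]
      simp [Fin.forall_fin_two, hc, ctr_tb_of_dvd d h1]
    · simp [Fin.forall_fin_two, hc]
  · -- shared coin
    by_cases hs : (x, d, (2 : Fin 3)) ∈ σ
    · simp [hs]
    · simp [hs, tb_ctr hk, dvd_ctr_apply]
  · -- selector
    simp

/-- The swap preserves the coin biases (both swapped coins are fair). -/
theorem prm_swap (k : ℕ) (ρ c₀ : ℝ) (σ : Set Coin) (c : Coin) :
    prm k ρ c₀ (((fun (σ : Set Coin) (c : Coin) =>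
      if c.2.2 = 1 then (if (c.1, c.2.1, (2 : Fin 3)) ∈ σ then c else (ctr k c.1, c.2.1, (0 : Fin 3)))
      else if c.2.2 = 0 then
        (if (∀ i, (k : ℤ) ∣ c.1 i) ∧ (tb k (c.1, c.2.1), c.2.1, (2 : Fin 3)) ∉ σ
          then (tb k (c.1, c.2.1), c.2.1, (1 : Fin 3)) else c)
      else c) σ c)) = prm k ρ c₀ c := by
  obtain ⟨x, d, l⟩ := c
  fin_cases l
  · by_cases hc : ((k : ℤ) ∣ x 0 ∧ (k : ℤ) ∣ x 1) ∧ (tb k (x, d), d, (2 : Fin 3)) ∉ σ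
    · have h1 : ∀ i, (k : ℤ) ∣ x i := fun i => by fin_cases i <;> simp [hc.1.1, hc.1.2]
      have hax : ax k (x, d) := ax_of_dvd h1 d
      simp [Fin.forall_fin_two, hc, prm, hax]
    · simp [Fin.forall_fin_two, hc]
  · by_cases hs : (x, d, (2 : Fin 3)) ∈ σ
    · simp [hs]
    · have hax : ax k (ctr k x, d) := ax_of_dvd (dvd_ctr_apply k x) d
      simp [hs, prm, hax]
  · simp

/-- The swap never moves a coin into or out of the selector layer. -/
theorem swap_layer_two_iff (k : ℕ) (σ : Set Coin) (c : Coin) :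
    (((fun (σ : Set Coin) (c : Coin) =>
      if c.2.2 = 1 then (if (c.1, c.2.1, (2 : Fin 3)) ∈ σ then c else (ctr k c.1, c.2.1, (0 : Fin 3)))
      else if c.2.2 = 0 then
        (if (∀ i, (k : ℤ) ∣ c.1 i) ∧ (tb k (c.1, c.2.1), c.2.1, (2 : Fin 3)) ∉ σ
          then (tb k (c.1, c.2.1), c.2.1, (1 : Fin 3)) else c)
      else c) σ c)).2.2 = 2 ↔ c.2.2 = 2 := by
  obtain ⟨x, d, l⟩ := c
  fin_cases l
  · by_cases hc : ((k : ℤ) ∣ x 0 ∧ (k : ℤ) ∣ x 1) ∧ (tb k (x, d), d, (2 : Fin 3)) ∉ σ <;>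
      simp [Fin.forall_fin_two, hc]
  · by_cases hs : (x, d, (2 : Fin 3)) ∈ σ <;> simp [hs]
  · simp

/-! ### The modified coin configuration `{c | swap_S c ∈ S}` -/

/-- The swap only reads the selector layer. -/
theorem swap_congr (k : ℕ) {S S' : Set Coin} (h : ∀ c : Coin, c.2.2 = 2 → (c ∈ S ↔ c ∈ S')) (c : Coin) :
    ((fun (σ : Set Coin) (c : Coin) =>
      if c.2.2 = 1 then (if (c.1, c.2.1, (2 : Fin 3)) ∈ σ then c else (ctr k c.1, c.2.1, (0 : Fin 3)))
      else if c.2.2 = 0 then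
        (if (∀ i, (k : ℤ) ∣ c.1 i) ∧ (tb k (c.1, c.2.1), c.2.1, (2 : Fin 3)) ∉ σ
          then (tb k (c.1, c.2.1), c.2.1, (1 : Fin 3)) else c)
      else c) S c) = ((fun (σ : Set Coin) (c : Coin) =>
      if c.2.2 = 1 then (if (c.1, c.2.1, (2 : Fin 3)) ∈ σ then c else (ctr k c.1, c.2.1, (0 : Fin 3)))
      else if c.2.2 = 0 then
        (if (∀ i, (k : ℤ) ∣ c.1 i) ∧ (tb k (c.1, c.2.1), c.2.1, (2 : Fin 3)) ∉ σ
          then (tb k (c.1, c.2.1), c.2.1, (1 : Fin 3)) else c)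
      else c) S' c) := by
  obtain ⟨x, d, l⟩ := c
  fin_cases l
  · simp [h (tb k (x, d), d, 2) rfl]
  · simp [h (x, d, 2) rfl]
  · simp

/-- The modified coin configuration is a measurable function of the coins. -/
theorem measurable_swap_preimage (k : ℕ) :
    Measurable fun S : Set Coin => {c : Coin | ((fun (σ : Set Coin) (c : Coin) =>
      if c.2.2 = 1 then (if (c.1, c.2.1, (2 : Fin 3)) ∈ σ then c else (ctr k c.1, c.2.1, (0 : Fin 3)))
      else if c.2.2 = 0 then
        (if (∀ i, (k : ℤ) ∣ c.1 i) ∧ (tb k (c.1, c.2.1), c.2.1, (2 : Fin 3)) ∉ σ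
          then (tb k (c.1, c.2.1), c.2.1, (1 : Fin 3)) else c)
      else c) S c) ∈ S} := by
  refine measurable_set_iff.2 fun c => ?_
  obtain ⟨x, d, l⟩ := c
  simp only [Set.mem_setOf_eq]
  fin_cases l
  · have h : (fun S : Set Coin => ((fun (σ : Set Coin) (c : Coin) =>
      if c.2.2 = 1 then (if (c.1, c.2.1, (2 : Fin 3)) ∈ σ then c else (ctr k c.1, c.2.1, (0 : Fin 3)))
      else if c.2.2 = 0 then
        (if (∀ i, (k : ℤ) ∣ c.1 i) ∧ (tb k (c.1, c.2.1), c.2.1, (2 : Fin 3)) ∉ σ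
          then (tb k (c.1, c.2.1), c.2.1, (1 : Fin 3)) else c)
      else c) S (x, d, (0 : Fin 3))) ∈ S) = fun S : Set Coin =>
        ((((k : ℤ) ∣ x 0 ∧ (k : ℤ) ∣ x 1) ∧ (tb k (x, d), d, (2 : Fin 3)) ∉ S) ∧ (tb k (x, d), d, (1 : Fin 3)) ∈ S) ∨
        (¬ (((k : ℤ) ∣ x 0 ∧ (k : ℤ) ∣ x 1) ∧ (tb k (x, d), d, (2 : Fin 3)) ∉ S) ∧ (x, d, (0 : Fin 3)) ∈ S) := by
      funext S
      by_cases hc : ((k : ℤ) ∣ x 0 ∧ (k : ℤ) ∣ x 1) ∧ (tb k (x, d), d, (2 : Fin 3)) ∉ S <;>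
        simp [Fin.forall_fin_two, hc]
    simp only [Fin.zero_eta] at h ⊢
    rw [h]
    exact Measurable.or ((measurable_const.and (measurable_set_notMem _)).and (measurable_set_mem _))
      ((measurable_const.and (measurable_set_notMem _)).not.and (measurable_set_mem _))
  · have h : (fun S : Set Coin => ((fun (σ : Set Coin) (c : Coin) =>
      if c.2.2 = 1 then (if (c.1, c.2.1, (2 : Fin 3)) ∈ σ then c else (ctr k c.1, c.2.1, (0 : Fin 3)))
      else if c.2.2 = 0 then
        (if (∀ i, (k : ℤ) ∣ c.1 i) ∧ (tb k (c.1, c.2.1), c.2.1, (2 : Fin 3)) ∉ σ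
          then (tb k (c.1, c.2.1), c.2.1, (1 : Fin 3)) else c)
      else c) S (x, d, (1 : Fin 3))) ∈ S) = fun S : Set Coin =>
        ((x, d, (2 : Fin 3)) ∈ S ∧ (x, d, (1 : Fin 3)) ∈ S) ∨ ((x, d, (2 : Fin 3)) ∉ S ∧ (ctr k x, d, (0 : Fin 3)) ∈ S) := by
      funext S
      by_cases hs : (x, d, (2 : Fin 3)) ∈ S <;> simp [hs]
    simp only [Fin.mk_one] at h ⊢
    rw [h]
    exact ((measurable_set_mem _).and (measurable_set_mem _)).or
      ((measurable_set_notMem _).and (measurable_set_mem _))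
  · have h : (fun S : Set Coin => ((fun (σ : Set Coin) (c : Coin) =>
      if c.2.2 = 1 then (if (c.1, c.2.1, (2 : Fin 3)) ∈ σ then c else (ctr k c.1, c.2.1, (0 : Fin 3)))
      else if c.2.2 = 0 then
        (if (∀ i, (k : ℤ) ∣ c.1 i) ∧ (tb k (c.1, c.2.1), c.2.1, (2 : Fin 3)) ∉ σ
          then (tb k (c.1, c.2.1), c.2.1, (1 : Fin 3)) else c)
      else c) S (x, d, (2 : Fin 3))) ∈ S) = fun S : Set Coin => (x, d, (2 : Fin 3)) ∈ S := by
      funext S; simp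
    simp only [Fin.reduceFinMk] at h ⊢
    rw [h]
    exact measurable_set_mem _

/-- **The modified read-out is measurable.** -/
theorem measurable_readout (k : ℕ) :
    Measurable fun S : Set Coin => cfg k {c : Coin | ((fun (σ : Set Coin) (c : Coin) =>
      if c.2.2 = 1 then (if (c.1, c.2.1, (2 : Fin 3)) ∈ σ then c else (ctr k c.1, c.2.1, (0 : Fin 3)))
      else if c.2.2 = 0 then
        (if (∀ i, (k : ℤ) ∣ c.1 i) ∧ (tb k (c.1, c.2.1), c.2.1, (2 : Fin 3)) ∉ σ
          then (tb k (c.1, c.2.1), c.2.1, (1 : Fin 3)) else c)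
      else c) S c) ∈ S} :=
  (measurable_cfg k).comp (measurable_swap_preimage k)

/-- **The modified read-out of the fine edge `(v, d)`**: an axial edge is open iff (selector on
and shared coin on) or (selector off and: the SHARED coin on if the edge is the first sub-edge of
its bundle (`v ∈ kℤ²`), its own coin on otherwise); a non-axial edge iff its own coin is on. -/
theorem edgeOf_mem_readout_iff {k : ℕ} (hk : 0 < k) (S : Set Coin) (v : Site 2) (d : Fin 2) :
    edgeOf (v, d) ∈ cfg k {c : Coin | ((fun (σ : Set Coin) (c : Coin) =>
      if c.2.2 = 1 then (if (c.1, c.2.1, (2 : Fin 3)) ∈ σ then c else (ctr k c.1, c.2.1, (0 : Fin 3)))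
      else if c.2.2 = 0 then
        (if (∀ i, (k : ℤ) ∣ c.1 i) ∧ (tb k (c.1, c.2.1), c.2.1, (2 : Fin 3)) ∉ σ
          then (tb k (c.1, c.2.1), c.2.1, (1 : Fin 3)) else c)
      else c) S c) ∈ S} ↔ (if ax k (v, d) then
          ((tb k (v, d), d, (2 : Fin 3)) ∈ S ∧ (tb k (v, d), d, (1 : Fin 3)) ∈ S) ∨
            ((tb k (v, d), d, (2 : Fin 3)) ∉ S ∧
              (((∀ i, (k : ℤ) ∣ v i) ∧ (tb k (v, d), d, (1 : Fin 3)) ∈ S) ∨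
                ((¬ ∀ i, (k : ℤ) ∣ v i) ∧ (v, d, (0 : Fin 3)) ∈ S)))
        else (v, d, (0 : Fin 3)) ∈ S) := by
  have key : opn k {c : Coin | ((fun (σ : Set Coin) (c : Coin) =>
      if c.2.2 = 1 then (if (c.1, c.2.1, (2 : Fin 3)) ∈ σ then c else (ctr k c.1, c.2.1, (0 : Fin 3)))
      else if c.2.2 = 0 then
        (if (∀ i, (k : ℤ) ∣ c.1 i) ∧ (tb k (c.1, c.2.1), c.2.1, (2 : Fin 3)) ∉ σ
          then (tb k (c.1, c.2.1), c.2.1, (1 : Fin 3)) else c)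
      else c) S c) ∈ S} (v, d) ↔ (if ax k (v, d) then
          ((tb k (v, d), d, (2 : Fin 3)) ∈ S ∧ (tb k (v, d), d, (1 : Fin 3)) ∈ S) ∨
            ((tb k (v, d), d, (2 : Fin 3)) ∉ S ∧
              (((∀ i, (k : ℤ) ∣ v i) ∧ (tb k (v, d), d, (1 : Fin 3)) ∈ S) ∨
                ((¬ ∀ i, (k : ℤ) ∣ v i) ∧ (v, d, (0 : Fin 3)) ∈ S)))
        else (v, d, (0 : Fin 3)) ∈ S) := by
    have htb : tb k (ctr k (tb k (v, d)), d) = tb k (v, d) := tb_ctr hk _ _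
    by_cases hax : ax k (v, d)
    · by_cases hsel : (tb k (v, d), d, (2 : Fin 3)) ∈ S
      · simp [opn, hax, hsel]
      · by_cases hdv : (k : ℤ) ∣ v 0 ∧ (k : ℤ) ∣ v 1
        · have h1 : ∀ i, (k : ℤ) ∣ v i := fun i => by fin_cases i <;> simp [hdv.1, hdv.2]
          have hct : ctr k (tb k (v, d)) = v := ctr_tb_of_dvd d h1
          simp [opn, hax, hsel, hdv, Fin.forall_fin_two, hct]
        · simp [opn, hax, hsel, hdv, Fin.forall_fin_two]
    · have hdv : ¬ ((k : ℤ) ∣ v 0 ∧ (k : ℤ) ∣ v 1) := by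
        intro h
        have h1 : ∀ i, (k : ℤ) ∣ v i := fun i => by fin_cases i <;> simp [h.1, h.2]
        exact hax (h1 _)
      simp [opn, hax, hdv, Fin.forall_fin_two]
  constructor
  · rintro ⟨v', d', he, hopn⟩
    obtain ⟨rfl, rfl⟩ : v = v' ∧ d = d' := by
      have := edgeOf_injective (a₁ := (v, d)) (a₂ := (v', d')) he
      simpa using this
    exact key.1 hopn
  · intro h
    exact ⟨v, d, rfl, key.2 h⟩

/-- The swap fixes the selector layer pointwise. -/
theorem swap_of_layer_two (k : ℕ) (σ : Set Coin) {c : Coin} (hc : c.2.2 = 2) : ((fun (σ : Set Coin) (c : Coin) =>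
      if c.2.2 = 1 then (if (c.1, c.2.1, (2 : Fin 3)) ∈ σ then c else (ctr k c.1, c.2.1, (0 : Fin 3)))
      else if c.2.2 = 0 then
        (if (∀ i, (k : ℤ) ∣ c.1 i) ∧ (tb k (c.1, c.2.1), c.2.1, (2 : Fin 3)) ∉ σ
          then (tb k (c.1, c.2.1), c.2.1, (1 : Fin 3)) else c)
      else c) σ c) = c := by
  obtain ⟨x, d, l⟩ := c
  simp only at hc
  subst hc
  simp

/-- `T ↦ T ∪ L` is measurable on `Set Coin`. -/
theorem measurable_union_right_coin (L : Set Coin) : Measurable fun T : Set Coin => T ∪ L :=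
  measurable_set_iff.2 fun i => (measurable_set_mem i).or measurable_const

/-! ### The modified read-out has law `M_k` -/

/-- **The modified read-out has the law `M_k(q)`** (registered helper of the stub
`stub_fourArmAboveOne`).  Under the coin product `coinLaw k q`, the configuration read through the
swapped coins `{c | swap_S c ∈ S}` — every bundle whose selector is OFF has its shared coin and the
own coin of its first sub-edge exchanged — has the same law as `cfg k S`, namely `M_k(q)`:
conditionally on the selector layer `σ` the swap is a FIXED bias-preserving permutation `π_σ` of the
non-selector coins, which leaves the conditional coin product invariant
(`prodBernoulli_real_preimage_image_equiv`), and the far-field disintegration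
`prodBernoulli_real_eq_integral_cond` (conditioning on the non-selector coins' complement) glues the
conditional identities. -/
theorem coinLaw_map_readout_eq {k : ℕ} (hk : 0 < k) (q : ℝ × ℝ) :
    (coinLaw k q).map (fun S : Set Coin => cfg k {c : Coin | ((fun (σ : Set Coin) (c : Coin) =>
      if c.2.2 = 1 then (if (c.1, c.2.1, (2 : Fin 3)) ∈ σ then c else (ctr k c.1, c.2.1, (0 : Fin 3)))
      else if c.2.2 = 0 then
        (if (∀ i, (k : ℤ) ∣ c.1 i) ∧ (tb k (c.1, c.2.1), c.2.1, (2 : Fin 3)) ∉ σ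
          then (tb k (c.1, c.2.1), c.2.1, (1 : Fin 3)) else c)
      else c) S c) ∈ S}) = M k q.1 q.2 := by
  set sw : Set Coin → Coin → Coin := (fun (σ : Set Coin) (c : Coin) =>
      if c.2.2 = 1 then (if (c.1, c.2.1, (2 : Fin 3)) ∈ σ then c else (ctr k c.1, c.2.1, (0 : Fin 3)))
      else if c.2.2 = 0 then
        (if (∀ i, (k : ℤ) ∣ c.1 i) ∧ (tb k (c.1, c.2.1), c.2.1, (2 : Fin 3)) ∉ σ
          then (tb k (c.1, c.2.1), c.2.1, (1 : Fin 3)) else c)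
      else c) with hsw_def
  set K : Set Coin := {c | c.2.2 ≠ 2} with hK
  set rd : Set Coin → Set (Sym2 (Site 2)) := fun S : Set Coin => cfg k {c : Coin | sw S c ∈ S} with hrd
  have hrdm : Measurable rd := measurable_readout k
  have hcfg := measurable_cfg k
  haveI : IsProbabilityMeasure (coinLaw k q) := by
    change IsProbabilityMeasure (prodBernoulli (prm k q.1 q.2)); infer_instance
  haveI : IsProbabilityMeasure (M k q.1 q.2) := isProbabilityMeasure_M k q.1 q.2
  haveI : IsProbabilityMeasure ((coinLaw k q).map rd) := Measure.isProbabilityMeasure_map hrdm.aemeasurable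
  have hsw2 : ∀ (σ : Set Coin) (c : Coin), (sw σ c).2.2 = 2 ↔ c.2.2 = 2 := fun σ c => swap_layer_two_iff k σ c
  have hswfix : ∀ (σ : Set Coin) {c : Coin}, c.2.2 = 2 → sw σ c = c := fun σ c hc => swap_of_layer_two k σ hc
  have hswcongr : ∀ {S S' : Set Coin}, (∀ c : Coin, c.2.2 = 2 → (c ∈ S ↔ c ∈ S')) → ∀ c, sw S c = sw S' c :=
    fun h c => swap_congr k h c
  -- the conditional identity, for every frozen far field `S₀`
  have hcond : ∀ (S₀ : Set Coin) {E : Set (BondConfig (Site 2))}, MeasurableSet E →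
      ((coinLaw k q).map fun T : Set Coin => T ∩ K).real {T | T ∪ (S₀ \ K) ∈ rd ⁻¹' E} =
        ((coinLaw k q).map fun T : Set Coin => T ∩ K).real {T | T ∪ (S₀ \ K) ∈ cfg k ⁻¹' E} := by
    intro S₀ E hE
    set σ₀ : Set Coin := S₀ \ K with hσ₀
    have hσ₀2 : ∀ c ∈ σ₀, c.2.2 = 2 := fun c hc => by
      by_contra h; exact hc.2 h
    -- the fixed permutation of the coins at selector layer `σ₀`
    set π : Equiv.Perm Coin := Function.Involutive.toPerm (sw σ₀) (swap_involutive hk σ₀) with hπ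
    have hπc : ∀ c, π c = sw σ₀ c := fun c => rfl
    have hπs : ∀ c, π.symm c = sw σ₀ c := fun c => by
      rw [hπ, Function.Involutive.toPerm_symm]; rfl
    -- Claim A: the modified read-out of `(S ∩ K) ∪ σ₀` is the read-out of `(π '' S ∩ K) ∪ σ₀`
    have hA : ∀ S : Set Coin, rd (S ∩ K ∪ σ₀) = cfg k ((fun S : Set Coin => ⇑π '' S) S ∩ K ∪ σ₀) := by
      intro S
      have hsw : ∀ c, sw (S ∩ K ∪ σ₀) c = sw σ₀ c :=
        hswcongr fun c' hc' => by
          simp only [Set.mem_union, Set.mem_inter_iff, hK, Set.mem_setOf_eq, hc', ne_eq,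
            not_true_eq_false, and_false, false_or]
      simp only [hrd]
      congr 1
      ext c
      simp only [Set.mem_setOf_eq, Set.mem_union, Set.mem_inter_iff, Set.mem_image_equiv, hπs, hsw]
      have hlayer := hsw2 σ₀ c
      have hcK : c ∈ K ↔ c.2.2 ≠ 2 := Iff.rfl
      have hcK' : sw σ₀ c ∈ K ↔ (sw σ₀ c).2.2 ≠ 2 := Iff.rfl
      rw [hcK, hcK']
      constructor
      · rintro (⟨h1, h2⟩ | h3)
        · exact Or.inl ⟨h1, fun hc2 => h2 (hlayer.2 hc2)⟩
        · have hc2 : c.2.2 = 2 := hlayer.1 (hσ₀2 _ h3)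
          rw [hswfix σ₀ hc2] at h3
          exact Or.inr h3
      · rintro (⟨h1, h2⟩ | h3)
        · exact Or.inl ⟨h1, fun h => h2 (hlayer.1 h)⟩
        · have hc2 : c.2.2 = 2 := hσ₀2 _ h3
          rw [hswfix σ₀ hc2]
          exact Or.inr h3
    -- both sides as probabilities of events of the full coin configuration
    have hmeasT : ∀ {F : Set Coin → Set (Sym2 (Site 2))}, Measurable F →
        MeasurableSet {T : Set Coin | T ∪ σ₀ ∈ F ⁻¹' E} := fun hF =>
      (hF.comp (measurable_union_right_coin σ₀)) hE
    have hG : Measurable fun S : Set Coin => cfg k (S ∩ K ∪ σ₀) :=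
      hcfg.comp ((measurable_union_right_coin σ₀).comp (measurable_inter_right K))
    rw [map_measureReal_apply (measurable_inter_right K) (hmeasT hrdm),
      map_measureReal_apply (measurable_inter_right K) (hmeasT hcfg)]
    change (coinLaw k q).real {S | rd (S ∩ K ∪ σ₀) ∈ E} = (coinLaw k q).real {S | cfg k (S ∩ K ∪ σ₀) ∈ E}
    have hset : {S : Set Coin | rd (S ∩ K ∪ σ₀) ∈ E} =
        (fun S : Set Coin => ⇑π '' S) ⁻¹' {S | cfg k (S ∩ K ∪ σ₀) ∈ E} := by
      ext S
      simp only [Set.mem_setOf_eq, Set.mem_preimage, hA S]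
    rw [hset]
    exact prodBernoulli_real_preimage_image_equiv (prm k q.1 q.2) π
      (fun c => by rw [hπc]; exact prm_swap k q.1 q.2 σ₀ c) (hG hE)
  -- glue by the far-field disintegration
  refine Measure.ext fun E hE => ?_
  have hreal : ((coinLaw k q).map rd).real E = (M k q.1 q.2).real E := by
    rw [map_measureReal_apply hrdm hE, map_measureReal_apply hcfg hE]
    change (prodBernoulli (prm k q.1 q.2)).real (rd ⁻¹' E) = (prodBernoulli (prm k q.1 q.2)).real (cfg k ⁻¹' E)
    rw [prodBernoulli_real_eq_integral_cond (prm k q.1 q.2) K (hrdm hE),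
      prodBernoulli_real_eq_integral_cond (prm k q.1 q.2) K (hcfg hE)]
    exact integral_congr_ae (ae_of_all _ fun S₀ => hcond S₀ hE)
  rw [measureReal_def, measureReal_def] at hreal
  exact (ENNReal.toReal_eq_toReal_iff' (measure_ne_top _ _) (measure_ne_top _ _)).1 hreal

end Summit.CriticalPhenomena.CardyFormulaZ2.Theorems.CardySelfRefinement.FarField

end
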